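import Summits.ValiantsHypothesis.ValiantsHypothesis.Theorems.TwoProducts.RankThreeAffineToricWronskianDepthForm

/-!
# Toric Wronskians of monomials, part 13: ENGINE for mixed words — the Newton determinant with ARBITRARY class nodes, letter-indexed leading
scalars, coefficients of finite products (hypothesis-free algebra; (2a) of val-idea-crit-8 g6 VERDICT #128)

Sequel of ✓ `…ToricWronskianDepthNewton` / `…DepthForm` (W4b: `toricWNewt`, `toricWTri`, `det_toricWNewt`, `toricWLead`).  Consumer-neutral algebra for the
two located cells of #128 (2b): (L1′) — the POLARISED located coefficient of a MIXED word (distinct off-line letters; memo rev D: at the (2,2) vertex the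
Markov form `y_a y_b (y_a² − 3y_a y_b + y_b² + 1)`) — and (M-a′) — the K = 3 pure layers `c₂, c₃` beyond the defect.  Nothing here carries a hypothesis
shape; no genericity is assumed.
§1 ★★ `det_toricWNewt_nodes_mul` (hypothesis-free): for ANY `x : Fin K → ℂ` and class data `b`,
`det[newt(class nodes of i′)_{a,ℓ_{i′}}]·Π_i Π_{j<i,∼}(x_i − x_j) = Π_i Π_{j<i}(x_i − x_j)` (✓ `toricW_vandermonde_transpose_eq` + ✓ `det_toricWTri` +
`Matrix.det_vandermonde`), and ★ `det_toricWNewt_nodes`: for `x` injective on the classes the Newton determinant is the CROSS-CLASS Vandermonde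
`Π_i Π_{j<i,≁}(x_i − x_j)` (✓ `det_toricWNewt` is the arithmetic-progression case `β_c + ℓγ`; mixed words need the nodes `β_c, β_c + γ_{p_c}`).
§2 ★ `toricWLeadS β γ κ a S` — the leading scalar of the ray table along a MULTISET `S` of off-line letters (word `v^{a−|S|} ⊔ S`):
`L_{a+1}(S) = (β + Σ_{p∈S} γ_p)·L_a(S) + Σ_{p∈S distinct} κ_p·L_a(S − p)`; `L_a(S) = 0` for `|S| > a`, `L_a(0) = β^a`, ★ `toricWLeadS_replicate`:
`L_a(j·{p}) = toricWLead β γ_p κ_p a j` (W4b's pure-layer scalar) and `toricWLeadS_singleton`.  (The identification `coeff_{word} M_{a,|S|} = L_a(S)` needs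
an additive-independence hypothesis on `supp u` and is the consumer's, #128 (2b).)
§3 ★ `coeff_finset_prod`: `coeff_d (Π_{i∈s} f_i) = Σ_{l ∈ finsuppAntidiag s d} Π_i coeff_{l i} f_i` for bivariate polynomials (transport of
`MvPowerSeries.coeff_prod` along the coercion).  HONEST LABEL: algebra / bookkeeping for located cells on the OPEN rung 3-AFF (side ladder, crux
`stmt-ValiantsHypothesis-5906` `TwoProducts`); `ConeTopBound`-uniform, `OLMLaw`, `RankThreeAffineLaw(Exp)`, `TwoProducts`, PCB, `ResidualLawV25` UNMOVED;
0 summit distance; VP ≠ VNP is NOT proved; no summit statement is proved here.  `--supports stmt-ValiantsHypothesis-5906 --as helper` (val-port-4 g6;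
critic of record val-idea-crit-8 g6).  One new data def with parameters (`toricWLeadS`); no Prop-defs, no instances, no notation, no named facts. [folklore]
-/

noncomputable section
set_option linter.dupNamespace false

namespace Summit.ValiantsHypothesis.ValiantsHypothesis.Theorems.TwoProducts.RankTwoJacobian

open scoped BigOperators
open MvPolynomial
open Literature.LinearAlgebra.Matrix (wronskianMatrix wronskian wronskianMatrix_apply wronskian_def)

section TowerKernel
open scoped Classical

/-! ### §1 The Newton determinant with ARBITRARY class nodes -/

/-- ★★ **HYBRID VANDERMONDE, general nodes (hypothesis-free):** for any `x : Fin K → ℂ` and class data `b`,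
`det[newt(class nodes of i′)_{a,ℓ_{i′}}]_{a,i′} · Π_i Π_{j<i, j∼i} (x_i − x_j) = Π_i Π_{j<i} (x_i − x_j) = det Vandermonde(x)ᵀ`
(✓ `toricW_vandermonde_transpose_eq`: `Vᵀ = H′·T`, ✓ `det_toricWTri`).  The nodes of the class of `i′` are the values `x_j` of its members in rank order. -/
theorem det_toricWNewt_nodes_mul {K : ℕ} (b : Fin K → Expo) (x : Fin K → ℂ) :
    (Matrix.of fun (a i' : Fin K) => toricWNewt (toricWNodes b x (b i')) (a : ℕ) (toricWRank b i')).det *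
        (∏ i : Fin K, ∏ j ∈ (Finset.univ : Finset (Fin K)).filter (fun j => j < i ∧ b j = b i), (x i - x j)) =
      ∏ i : Fin K, ∏ j ∈ Finset.Iio i, (x i - x j) := by
  have hdet := congrArg Matrix.det (toricW_vandermonde_transpose_eq b x)
  rw [Matrix.det_transpose, Matrix.det_mul, det_toricWTri, Matrix.det_vandermonde] at hdet
  rw [← hdet, Finset.prod_comm' (s := Finset.univ) (t := fun i => Finset.Ioi i) (t' := Finset.univ) (s' := fun j => Finset.Iio j)
      (fun a c => by simp)]

/-- ★ divided form: if `x` is injective on every class, `det[newt(class nodes)_{a,ℓ_{i′}}] = Π_i Π_{j<i, j≁i} (x_i − x_j)` — the CROSS-CLASS Vandermonde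
(✓ `det_toricWNewt` is the case of the arithmetic progressions `β_c + ℓγ`). -/
theorem det_toricWNewt_nodes {K : ℕ} (b : Fin K → Expo) (x : Fin K → ℂ) (hx : ∀ i j : Fin K, j < i → b j = b i → x j ≠ x i) :
    (Matrix.of fun (a i' : Fin K) => toricWNewt (toricWNodes b x (b i')) (a : ℕ) (toricWRank b i')).det =
      ∏ i : Fin K, ∏ j ∈ (Finset.univ : Finset (Fin K)).filter (fun j => j < i ∧ b j ≠ b i), (x i - x j) := by
  have h := det_toricWNewt_nodes_mul b x
  have hsplit : ∏ i : Fin K, ∏ j ∈ Finset.Iio i, (x i - x j) =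
      (∏ i : Fin K, ∏ j ∈ (Finset.univ : Finset (Fin K)).filter (fun j => j < i ∧ b j ≠ b i), (x i - x j)) *
        ∏ i : Fin K, ∏ j ∈ (Finset.univ : Finset (Fin K)).filter (fun j => j < i ∧ b j = b i), (x i - x j) := by
    rw [← Finset.prod_mul_distrib]
    refine Finset.prod_congr rfl fun i _ => ?_
    rw [← Finset.prod_filter_mul_prod_filter_not (Finset.Iio i) (fun j => b j ≠ b i)]
    congr 1
    · refine Finset.prod_congr (by ext j; simp [Finset.mem_Iio]) fun _ _ => rfl
    · refine Finset.prod_congr (by ext j; simp [Finset.mem_Iio]) fun _ _ => rfl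
  rw [hsplit] at h
  have hne : (∏ i : Fin K, ∏ j ∈ (Finset.univ : Finset (Fin K)).filter (fun j => j < i ∧ b j = b i), (x i - x j)) ≠ 0 :=
    Finset.prod_ne_zero_iff.mpr fun i _ => Finset.prod_ne_zero_iff.mpr fun j hj =>
      sub_ne_zero.mpr (Ne.symm (hx i j (Finset.mem_filter.mp hj).2.1 (Finset.mem_filter.mp hj).2.2))
  exact mul_right_cancel₀ hne h

/-! ### §2 Letter-indexed leading scalars -/

/-- the LEADING SCALAR of the ray table along a MULTISET `S` of off-line letters (word `v^{a−|S|} ⊔ S`): `L_0(S) = [S = 0]`,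
`L_{a+1}(S) = (β + Σ_{p∈S} γ_p)·L_a(S) + Σ_{p ∈ S (distinct)} κ_p·L_a(S − p)` (`β = u_v det(b,v)`, `γ_p = u_v det(p,v)`, `κ_p = u_p det(q,p)`): the next
letter is `v` (from `ε_b` or the `J`-step, eigenvalue `β + Σγ`) or a NEW letter `p` from `ε_q`.  `S = j·{q}` gives ✓ `toricWLead` (`toricWLeadS_replicate`);
distinct letters give the polarised scalars of the mixed words (val-idea-crit-8 g6 memo rev D (L1′)). [folklore] -/
def toricWLeadS (β : ℂ) (γ κ : Expo → ℂ) : ℕ → Multiset Expo → ℂ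
  | 0, S => if S = 0 then 1 else 0
  | a + 1, S => (β + (S.map γ).sum) * toricWLeadS β γ κ a S + ∑ p ∈ S.toFinset, κ p * toricWLeadS β γ κ a (S.erase p)

/-- `L_a(S) = 0` when `|S| > a`. [folklore] -/
theorem toricWLeadS_eq_zero (β : ℂ) (γ κ : Expo → ℂ) : ∀ (a : ℕ) (S : Multiset Expo), a < Multiset.card S → toricWLeadS β γ κ a S = 0
  | 0, S, h => by
    have hS : S ≠ 0 := by rintro rfl; simp at h
    simp [toricWLeadS, hS]
  | a + 1, S, h => by
    simp only [toricWLeadS]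
    rw [toricWLeadS_eq_zero β γ κ a S (by omega), mul_zero, zero_add]
    refine Finset.sum_eq_zero fun p hp => ?_
    rw [toricWLeadS_eq_zero β γ κ a (S.erase p) (by rw [Multiset.card_erase_of_mem (Multiset.mem_toFinset.mp hp), Nat.pred_eq_sub_one]; omega),
      mul_zero]

/-- the empty word of letters: `L_a(0) = β^a` (the corner). [folklore] -/
theorem toricWLeadS_zero (β : ℂ) (γ κ : Expo → ℂ) : ∀ a : ℕ, toricWLeadS β γ κ a 0 = β ^ a
  | 0 => by simp [toricWLeadS]
  | a + 1 => by
    simp only [toricWLeadS, Multiset.map_zero, Multiset.sum_zero, add_zero, Multiset.toFinset_zero, Finset.sum_empty]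
    rw [toricWLeadS_zero β γ κ a, pow_succ]; ring

/-- ★ repeated letter: `L_a(j·{p}) = toricWLead β γ_p κ_p a j` — the pure-layer scalar of ✓ `toricW_coef_lead` (W4b). [folklore] -/
theorem toricWLeadS_replicate (β : ℂ) (γ κ : Expo → ℂ) (p : Expo) : ∀ a j : ℕ, toricWLeadS β γ κ a (Multiset.replicate j p) = toricWLead β (γ p) (κ p) a j
  | 0, j => by
    unfold toricWLead
    by_cases hj : j = 0
    · subst hj; simp [toricWLeadS, toricWNewt]
    · have hne : Multiset.replicate j p ≠ 0 := fun h => hj (by simpa using congrArg Multiset.card h)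
      simp [toricWLeadS, toricWNewt, hj, hne]
  | a + 1, j => by
    by_cases hj : j = 0
    · subst hj
      simp only [toricWLeadS, Multiset.replicate_zero, Multiset.map_zero, Multiset.sum_zero, add_zero, Multiset.toFinset_zero,
        Finset.sum_empty]
      rw [toricWLeadS_zero, toricWLead_succ, if_pos rfl, add_zero]
      unfold toricWLead
      have h0 : ∀ n : ℕ, toricWNewt (fun t => β + (t : ℂ) * γ p) n 0 = β ^ n := by
        intro n
        induction n with
        | zero => simp [toricWNewt]
        | succ n ih => simp only [toricWNewt, if_true, Nat.cast_zero, zero_mul, add_zero]; rw [ih, pow_succ]; ring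
      rw [h0]; push_cast; ring
    · obtain ⟨j', rfl⟩ := Nat.exists_eq_add_one_of_ne_zero hj
      have hto : (Multiset.replicate (j' + 1) p).toFinset = {p} := by
        ext x
        rw [Multiset.mem_toFinset, Multiset.mem_replicate, Finset.mem_singleton]
        exact ⟨fun h => h.2, fun h => ⟨hj, h⟩⟩
      have her : (Multiset.replicate (j' + 1) p).erase p = Multiset.replicate j' p := by
        rw [Multiset.replicate_succ, Multiset.erase_cons_head]
      have hmap : ((Multiset.replicate (j' + 1) p).map γ).sum = ((j' + 1 : ℕ) : ℂ) * γ p := by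
        rw [Multiset.map_replicate, Multiset.sum_replicate, nsmul_eq_mul]
      simp only [toricWLeadS]
      rw [hto, Finset.sum_singleton, her, hmap, toricWLeadS_replicate β γ κ p a (j' + 1), toricWLeadS_replicate β γ κ p a j',
        toricWLead_succ, if_neg hj, Nat.add_sub_cancel]

/-- one letter: `L_a({p}) = κ_p · h_{a−1}(β, β + γ_p)` (the depth-1 scalar of ✓ `toricW_first_layer`). [folklore] -/
theorem toricWLeadS_singleton (β : ℂ) (γ κ : Expo → ℂ) (p : Expo) (a : ℕ) : toricWLeadS β γ κ a {p} = toricWLead β (γ p) (κ p) a 1 := by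
  rw [← Multiset.replicate_one, toricWLeadS_replicate]

/-! ### §3 Coefficients of finite products (transport of `MvPowerSeries.coeff_prod`) -/

/-- ★ the coefficient of a finite product of bivariate polynomials at `d` is the sum over the antidiagonal decompositions `Σ_i l_i = d` of the products of
coefficients (✓ `MvPowerSeries.coeff_prod` through the coercion `Poly2 → MvPowerSeries`). [folklore] -/
theorem coeff_finset_prod {ι : Type*} (s : Finset ι) (f : ι → Poly2) (d : Expo) :
    coeff d (∏ i ∈ s, f i) = ∑ l ∈ s.finsuppAntidiag d, ∏ i ∈ s, coeff (l i) (f i) := by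
  have h := MvPowerSeries.coeff_prod (fun i => (f i : MvPowerSeries (Fin 2) ℂ)) d s
  simp only [MvPolynomial.coeff_coe] at h
  rw [← h, ← MvPolynomial.coeff_coe]
  congr 1
  rw [← MvPolynomial.coeToMvPowerSeries.ringHom_apply, map_prod]
  rfl

end TowerKernel

end Summit.ValiantsHypothesis.ValiantsHypothesis.Theorems.TwoProducts.RankTwoJacobian

end
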